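import Summits.BirchSwinnertonDyer.BirchSwinnertonDyer.Theses.EisensteinPrimes
import Literature.NumberTheory.EllipticCurves.CastellaGrossiSkinner2025.PerrinRiouMainConjectureProofs
import Literature.NumberTheory.EllipticCurves.CastellaGrossiSkinner2025.MazurMainConjectureRankOne
import Literature.NumberTheory.EllipticCurves.CastellaGrossiLeeSkinner2022.AnticyclotomicControlTorsionFree
import Literature.NumberTheory.EllipticCurves.KellerYin2024.AnomalousAnticyclotomicMainConjecture
import Literature.NumberTheory.EllipticCurves.ZpExtensionAnticyclotomicHoldsProofs
import Literature.NumberTheory.EllipticCurves.SelmerCorankHolds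
import Literature.NumberTheory.EllipticCurves.SupersingularIrreducibleProofs
import HarnessLib

/-!
# Crux `MazurMCOnX1RankZero` (item stmt-BirchSwinnertonDyer-19035), line `interlude_with_torsion`:
# stub `stub_plusLineValue` — crux 2 ∘ (K1) ⟹ the BDP value on the CYCLOTOMIC line at the good lattice

Cell `bsd-eis` (host `run/shared/lean/pub/bsd-eis/`), lead `bsd-line-x1-p2` (g3); `--supports`
stmt-BirchSwinnertonDyer-19035; theorems only. No summit statement (BSD, Mazur's main conjecture,
IMC2) is proved here; crux 2 (`GoodLatticeBDPValue`, Keller–Yin Thm. 3.0.8 = PREPRINT) and the line's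
stub (K1) enter as HYPOTHESES, the control theorem [CGLS] Thm. 5.1.1 (as proved, refereed) as a named
fact.

THE STUB (birth skeleton `Cruxes/MazurMCOnX1RankZero/Lines/interlude_with_torsion.lean`, 36cf6428…:
`stub_plusLineValue : PublishedFacts → GoodLatticeBDPValue → TwoLineEulerCharWithTorsion →
CycLineBDPValueGoodLattice`; re-typed by the lead in skeleton v2 to the header of `stub_plusLineValue`
below, VERBATIM). Proved here with the three line currencies UNFOLDED (the line file is a crux workfile
and is not importable under `Theorems/`), and with `PublishedFacts` cut down to the one conjunct the
proof consumes ([CGLS] Thm. 5.1.1 as proved, `thm511_anticyclotomicControl_of_torsionFree`); in the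
skeleton the birth stub is the one-liner `fun hpub h2 hK1 ↦ stub_plusLineValue hpub.2.2.2.2.2.2.2.2.2.1 h2 hK1`.
Contents: `cycLineBDPValue_of_localTransport` (the plumbing with the two-line transport as a LOCAL
hypothesis at the datum), `stub_plusLineValue` (fed by (K1) verbatim), `stub_plusLineValue_of_prop342`
(fed by PRINT: [CGS25] Prop. 3.4.2 at `α = 𝟙`, unfolded), two folklore helpers.

PROOF (Castella–Grossi–Skinner, Math. Ann. 393 (2025) §5 "Interlude", Step 1, display after (5.1):
`𝓕_Gr⁺(0) ∼_p 𝓕_Gr⁻(0) ∼_p 𝓛^BDP(0) ≠ 0`, run at the anomalous good lattice). Given the data of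
`CycLineBDPValueGoodLattice` (`E_g` with no unramified rational `p`-line, `K` Heegner with `p = v v̄`
split, `E_g(K)[p] = 0`, `rank E_g(K) = 1`, `Ш(E_g/K)[p^∞]` finite, the cyclotomic pair `(κ, γ)`, a
modular parametrisation and Heegner datum): (Sel) `corank Sel_{p^∞}(E_g/K) = 1` and a point `P₀` of
infinite order by the corank identity (tree theorem `selmerCorank_eq_mordellWeilRank_add_holds`);
pick an anticyclotomic `ℤ_p`-extension `κ₋` of `K` (tree theorem `ZpExtension.exists_isAnticyclotomic_holds`)
with a topological generator `γ₋`; [CGLS] Thm. 5.1.1 gives `X_Gr(E_g/K_∞⁻)` torsion with a generator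
`𝓕⁻`, `𝓕⁻(0) ≠ 0`; crux 2 gives `𝓕⁻(0) = u · X` for the SAME generator (`X` the BDP expression,
`generator_constantCoeff_eq_of_thm308`), so `ord_p 𝓕⁻(0) = n` say; (K1) transports `n` to the
cyclotomic line: `X_Gr(E_g/K_∞⁺)` torsion with a generator `𝓕⁺`, `𝓕⁺(0) ≠ 0`, `ord_p 𝓕⁺(0) = n`; two
non-zero `p`-adic integers of equal valuation differ by a unit (`PadicInt.unitCoeff`), whence
`𝓕⁺(0) = u' · X`. [cite: CastellaGrossiSkinner2025, §5 (Interlude) Step 1]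
[cite: CastellaGrossiLeeSkinner2022, Thm. 5.1.1 and its proof] [cite: KellerYin2024, Thm. 3.0.8 (IMC2)]

LEAD'S NOTE ON (K1) (desk check F1 of the line card, CGS final TeX `Mazur-paper_revised.tex`
l. 1469–1576): at the good lattice `E_g` one has `E_g(K)[p] = 0` (a binder of
`CycLineBDPValueGoodLattice`; tree theorem `torsion_baseChange_eq_zero_of_noUnramifiedLine`), and
(K1) restricted to `E(K)[p] = 0` IS Castella–Grossi–Skinner's printed Prop. 3.4.2 (`prop:euler-char`)
with Lemma 3.4.1 at `α = 𝟙` — stated under `E(K)[p] = 0`, (a), (b) and the §3 standing hypotheses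
(`p` odd good ordinary; (Heeg), (spl)) and NO non-anomalous hypothesis. The typed named fact follows
in `Literature/NumberTheory/EllipticCurves/CastellaGrossiSkinner2025/TwoLineEulerCharacteristic.lean`;
this file keeps (K1) VERBATIM as the registered hypothesis so that it lands independently.
-/

set_option linter.dupNamespace false
set_option autoImplicit false

noncomputable section

open scoped Classical

open WeierstrassCurve NumberField IsDedekindDomain Field
  Literature.NumberTheory.EllipticCurves Literature.NumberTheory.EllipticCurves.ModularForms
  Literature.NumberTheory.EllipticCurves.Rank1Residual
  Literature.NumberTheory.EllipticCurves.CyclotomicZp Literature.NumberTheory.EllipticCurves.Castella2018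
  Literature.NumberTheory.QuadraticFields

namespace Summit.BirchSwinnertonDyer.BirchSwinnertonDyer.Theorems.InterludeWithTorsion

/-- Two non-zero `p`-adic integers with the same valuation differ by a unit of `ℤ_p`
(`x = u_x p^{v(x)}`, `y = u_y p^{v(y)}`, `PadicInt.unitCoeff`). [folklore] -/
theorem exists_unit_mul_of_valuation_eq {p : ℕ} [Fact p.Prime] {a b : ℤ_[p]} (ha : a ≠ 0) (hb : b ≠ 0)
    (h : a.valuation = b.valuation) : ∃ w : ℤ_[p]ˣ, a = (w : ℤ_[p]) * b := by
  refine ⟨PadicInt.unitCoeff ha * (PadicInt.unitCoeff hb)⁻¹, ?_⟩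
  have ha' := PadicInt.unitCoeff_spec ha
  have hb' := PadicInt.unitCoeff_spec hb
  rw [h] at ha'
  calc a = _ := ha'
    _ = ((PadicInt.unitCoeff ha * (PadicInt.unitCoeff hb)⁻¹ : ℤ_[p]ˣ) : ℤ_[p]) *
          ((PadicInt.unitCoeff hb : ℤ_[p]) * (p : ℤ_[p]) ^ b.valuation) := by
      rw [Units.val_mul, mul_assoc, Units.inv_mul_cancel_left]
    _ = ((PadicInt.unitCoeff ha * (PadicInt.unitCoeff hb)⁻¹ : ℤ_[p]ˣ) : ℤ_[p]) * b := by rw [← hb']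

/-- A prime `v` of `K` cut out by an embedding `ι : K → ℚ_p` (`x ∈ v ⟺ ‖ι x‖ < 1`) lies above `p`:
`‖ι p‖ = ‖p‖_p = p⁻¹ < 1`. [folklore] -/
theorem natCast_mem_of_forall_mem_iff_norm_lt {K : Type} [Field K] [NumberField K] {p : ℕ} [Fact p.Prime]
    (ι : K →+* ℚ_[p]) (v : HeightOneSpectrum (𝓞 K))
    (hv : ∀ x : 𝓞 K, x ∈ v.asIdeal ↔ ‖ι (x : K)‖ < 1) : ((p : ℕ) : 𝓞 K) ∈ v.asIdeal := by
  rw [hv]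
  simp only [map_natCast]
  exact Padic.norm_p_lt_one

/-- **The plumbing, with the two-line transport as a LOCAL hypothesis at the datum.** Given the data of
the line currency `CycLineBDPValueGoodLattice` and, AT THAT DATUM, the transport "(Sel), a point of
infinite order, `v ∋ p` ⟹ for every anticyclotomic `κ₋` with generator `γ₋`: `ord_p 𝓕⁻(0) = n ⟹
ord_p 𝓕⁺(0) = n`" (supplied by (K1) verbatim in `stub_plusLineValue`, by [CGS25] Prop. 3.4.2 at
`α = 𝟙` in `stub_plusLineValue_of_prop342`): `X_Gr(E_g/K_∞⁺)` is torsion with a generator `𝓕⁺`,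
`𝓕⁺(0) ≠ 0`, `𝓕⁺(0) = u · c_E⁻² (1 − a_p p⁻¹ + p⁻¹)² log_{ω_E}(P_K)²`. Steps: corank identity ⟹ (Sel)
and `P₀` of infinite order; an anticyclotomic `κ₋` with generator; [CGLS22] Thm. 5.1.1 (as proved) on
the `−` line (`𝓕⁻(0) ≠ 0`); crux 2 for the same generator (`𝓕⁻(0) = u · X`); transport; unit ratio.
CONDITIONAL on `h2` (crux 2) and the named fact `h511`. [cite: CastellaGrossiSkinner2025, §5 (Interlude) Steps 1 and 3]
[cite: CastellaGrossiLeeSkinner2022, Thm. 5.1.1 and its proof] [cite: KellerYin2024, Thm. 3.0.8 (IMC2)] -/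
theorem cycLineBDPValue_of_localTransport
    (h511 : CastellaGrossiLeeSkinner2022.thm511_anticyclotomicControl_of_torsionFree)
    (h2 : Summit.BirchSwinnertonDyer.BirchSwinnertonDyer.Theses.EisensteinPrimes.GoodLatticeBDPValue) :
    ∀ (W : WeierstrassCurve ℚ) [W.IsElliptic] [W.IsGloballyMinimal] (p : ℕ) [Fact p.Prime],
      2 < p → Good W p → Red W p → Anom W p →
      (∀ Φ : AddSubgroup (geomTorsion W (p : ℤ)), IsRationalLine W p Φ → ¬ LineUnramifiedAt W p Φ) →
      ∀ (K : Type) [Field K] [NumberField K], IsImaginaryQuadratic K →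
        SatisfiesHeegnerHypothesis (W.conductorNorm ℤ) K → SatisfiesHeegnerHypothesis p K →
        Odd (NumberField.discr K) → NumberField.discr K ≠ -3 →
        (∀ Q : (W.baseChange K).toAffine.Point, p • Q = 0 → Q = 0) →
        (W.baseChange K).mordellWeilRank = 1 →
        Finite (AddCommGroup.primaryComponent (W.baseChange K).sha p) →
      ∀ (ι : K →+* ℚ_[p]) (v vbar : HeightOneSpectrum (𝓞 K)),
        (∀ x : 𝓞 K, x ∈ v.asIdeal ↔ ‖ι (x : K)‖ < 1) →
        ((p : ℕ) : 𝓞 K) ∈ vbar.asIdeal → vbar ≠ v →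
      ∀ (κ : ZpExtension K p), κ.IsCyclotomic →
      ∀ (γ : absoluteGaloisGroup K) [Fact (κ.IsTopGenerator γ)],
      ∀ (N : ℕ) [NeZero N] (Dt : ModularParametrizationData W N)
        (H : HeegnerDatum N (NumberField.discr K)) (ιC : K →+* ℂ) (P : (W.baseChange K).toAffine.Point),
        WeierstrassCurve.Affine.Point.map ιC.toRatAlgHom P = heegnerPointComplex Dt H →
        ((W.baseChange K).selmerCorank p = 1 →
          (∃ P₀ : (W.baseChange K).toAffine.Point, ¬ IsOfFinAddOrder P₀) →
          ((p : ℕ) : 𝓞 K) ∈ v.asIdeal →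
          ∀ (κm : ZpExtension K p), κm.IsAnticyclotomic →
          ∀ (γm : absoluteGaloisGroup K) [Fact (κm.IsTopGenerator γm)],
          ∀ n : ℕ, AcSelmer.XAc.HasCharValuationAt (W.baseChange K) p κm vbar ∅ γm n →
            AcSelmer.XAc.HasCharValuationAt (W.baseChange K) p κ vbar ∅ γ n) →
        Module.IsTorsion (IwasawaAlgebra p) (AcSelmer.XAc (W.baseChange K) p κ vbar ∅ γ) ∧
        ∃ F : IwasawaAlgebra p,
          AcSelmer.XAc.charIdeal (W.baseChange K) p κ vbar ∅ γ = Ideal.span {F} ∧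
          PowerSeries.constantCoeff F ≠ 0 ∧
          ∃ u : ℤ_[p]ˣ,
            ((PowerSeries.constantCoeff F : ℤ_[p]) : ℚ_[p]) =
              ((u : ℤ_[p]) : ℚ_[p]) * ((Dt.c : ℚ_[p])⁻¹) ^ 2 *
                (1 - (W.frobeniusTrace p : ℚ_[p]) * (p : ℚ_[p])⁻¹ + (p : ℚ_[p])⁻¹) ^ 2 *
                ((W.baseChange ℚ_[p]).padicLogPoint (formalIndex W p • padicPointOf W p ι P) /
                  (formalIndex W p : ℚ_[p])) ^ 2 := by
  intro W _ _ p _ hp hgood hred hanom hGL K _ _ hK hHN hHp hodd h3 hEK hrank hfin ι v vbar hv hvbar hne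
    κ hκ γ _ N _ Dt H ιC P hP htrans
  -- (Sel) and a point of infinite order, from rank 1 and finite `Ш[p^∞]` (corank identity)
  obtain ⟨hSel, P₀, hP₀⟩ :=
    CastellaGrossiSkinner2025.selmerCorank_eq_one_and_exists_not_isOfFinAddOrder W p
      ((W.baseChange K).selmerCorank_eq_mordellWeilRank_add_holds) hrank hfin
  -- an anticyclotomic `ℤ_p`-extension of `K` with a topological generator
  haveI : NumberField.IsTotallyComplex K := hK.2
  obtain ⟨κm, hκm⟩ := ZpExtension.exists_isAnticyclotomic_holds (K := K) (p := p) hK.1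
    (fun w ↦ NumberField.IsTotallyComplex.isComplex w)
  obtain ⟨γm, hγm⟩ := κm.surjective (Multiplicative.ofAdd 1)
  haveI : Fact (κm.IsTopGenerator γm) := ⟨hγm⟩
  -- [CGLS] Thm. 5.1.1 (as proved) on the anticyclotomic line: a generator with `𝓕⁻(0) ≠ 0`
  obtain ⟨htorsm, Fm, hFm, hFm0, -⟩ := h511 W p hp (goodOrd_of_red_of_good W p hp hgood hred) K hK hHp
    hHN ι v vbar hv hvbar hne κm hκm γm hEK hrank hfin P₀ hP₀
  -- crux 2 (KY IMC2 ∘ BDP) for the same generator: `𝓕⁻(0) = u · X`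
  obtain ⟨u, hu⟩ := KellerYin2024.generator_constantCoeff_eq_of_thm308 h2 hp hgood hred hanom hGL K hK
    hHN hHp hodd h3 hEK hSel ι v vbar hv hvbar hne κm hκm γm Dt H ιC P hP Fm hFm
  -- transport `n = ord_p 𝓕⁻(0)` to the cyclotomic line
  have hm : AcSelmer.XAc.HasCharValuationAt (W.baseChange K) p κm vbar ∅ γm
      (PowerSeries.constantCoeff Fm).valuation :=
    AcSelmer.XAc.hasCharValuationAt_of_eq htorsm hFm hFm0 rfl
  have hvp : ((p : ℕ) : 𝓞 K) ∈ v.asIdeal := natCast_mem_of_forall_mem_iff_norm_lt ι v hv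
  obtain ⟨htors, F, hF, hF0, hval⟩ := htrans hSel ⟨P₀, hP₀⟩ hvp κm hκm γm _ hm
  -- two non-zero `p`-adic integers of equal valuation differ by a unit
  obtain ⟨w, hw⟩ := exists_unit_mul_of_valuation_eq hF0 hFm0 hval
  refine ⟨htors, F, hF, hF0, w * u, ?_⟩
  rw [hw, PadicInt.coe_mul, hu, Units.val_mul, PadicInt.coe_mul]
  ring

/-- **Stub `stub_plusLineValue` of line `interlude_with_torsion` (crux `MazurMCOnX1RankZero`,
item stmt-BirchSwinnertonDyer-19035), REGISTERED SIGNATURE (skeleton v2): crux 2 ∘ (K1) ⟹ the BDP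
value on the CYCLOTOMIC line at the good lattice.** Hypotheses: `h511` = [CGLS] Thm. 5.1.1 as proved
(refereed named fact; the 10th conjunct of the line's `PublishedFacts`); `h2` = the route's crux 2
`GoodLatticeBDPValue` BY NAME (Keller–Yin Thm. 3.0.8 ∘ BDP at the good lattice, PREPRINT, open item
19032); `hK1` = the line's currency (K1) `TwoLineEulerCharWithTorsion` VERBATIM (two-line Euler
characteristic with torsion: `ord_p 𝓕⁻(0) = n ⟹ ord_p 𝓕⁺(0) = n`). Conclusion: the line's currency
`CycLineBDPValueGoodLattice` VERBATIM — for the good lattice at an anomalous Eisenstein `p > 2` and the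
cyclotomic pair `(κ, γ)` of a Heegner field `K` with `p` split, `X_Gr(E_g/K_∞⁺)` is `Λ`-torsion with a
generator `𝓕⁺`, `𝓕⁺(0) ≠ 0` and `𝓕⁺(0) = u · c_E⁻² (1 − a_p p⁻¹ + p⁻¹)² log_{ω_E}(P_K)²`, `u ∈ ℤ_p^×`.
CONDITIONAL on `h2` (open) and `hK1` (open stub); plumbing only (`cycLineBDPValue_of_localTransport`).
In the skeleton: `fun hpub h2 hK1 ↦ stub_plusLineValue hpub.2.2.2.2.2.2.2.2.2.1 h2 hK1`.
[cite: CastellaGrossiSkinner2025, §5 (Interlude) Step 1]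
[cite: CastellaGrossiLeeSkinner2022, Thm. 5.1.1 and its proof] [cite: KellerYin2024, Thm. 3.0.8 (IMC2)] -/
theorem stub_plusLineValue
    (h511 : CastellaGrossiLeeSkinner2022.thm511_anticyclotomicControl_of_torsionFree)
    (h2 : Summit.BirchSwinnertonDyer.BirchSwinnertonDyer.Theses.EisensteinPrimes.GoodLatticeBDPValue)
    (hK1 : ∀ (W : WeierstrassCurve ℚ) [W.IsElliptic] [W.IsGloballyMinimal] (p : ℕ) [Fact p.Prime],
      2 < p → Good W p →
      ∀ (K : Type) [Field K] [NumberField K], IsImaginaryQuadratic K →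
        SatisfiesHeegnerHypothesis (W.conductorNorm ℤ) K → SatisfiesHeegnerHypothesis p K →
        (W.baseChange K).selmerCorank p = 1 →
        (∃ P : (W.baseChange K).toAffine.Point, ¬ IsOfFinAddOrder P) →
      ∀ (v vbar : HeightOneSpectrum (𝓞 K)),
        ((p : ℕ) : 𝓞 K) ∈ v.asIdeal → ((p : ℕ) : 𝓞 K) ∈ vbar.asIdeal → vbar ≠ v →
      ∀ (κp κm : ZpExtension K p), κp.IsCyclotomic → κm.IsAnticyclotomic →
      ∀ (γp γm : absoluteGaloisGroup K) [Fact (κp.IsTopGenerator γp)] [Fact (κm.IsTopGenerator γm)],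
      ∀ n : ℕ, AcSelmer.XAc.HasCharValuationAt (W.baseChange K) p κm vbar ∅ γm n →
        AcSelmer.XAc.HasCharValuationAt (W.baseChange K) p κp vbar ∅ γp n) :
    ∀ (W : WeierstrassCurve ℚ) [W.IsElliptic] [W.IsGloballyMinimal] (p : ℕ) [Fact p.Prime],
      2 < p → Good W p → Red W p → Anom W p →
      (∀ Φ : AddSubgroup (geomTorsion W (p : ℤ)), IsRationalLine W p Φ → ¬ LineUnramifiedAt W p Φ) →
      ∀ (K : Type) [Field K] [NumberField K], IsImaginaryQuadratic K →
        SatisfiesHeegnerHypothesis (W.conductorNorm ℤ) K → SatisfiesHeegnerHypothesis p K →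
        Odd (NumberField.discr K) → NumberField.discr K ≠ -3 →
        (∀ Q : (W.baseChange K).toAffine.Point, p • Q = 0 → Q = 0) →
        (W.baseChange K).mordellWeilRank = 1 →
        Finite (AddCommGroup.primaryComponent (W.baseChange K).sha p) →
      ∀ (ι : K →+* ℚ_[p]) (v vbar : HeightOneSpectrum (𝓞 K)),
        (∀ x : 𝓞 K, x ∈ v.asIdeal ↔ ‖ι (x : K)‖ < 1) →
        ((p : ℕ) : 𝓞 K) ∈ vbar.asIdeal → vbar ≠ v →
      ∀ (κ : ZpExtension K p), κ.IsCyclotomic →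
      ∀ (γ : absoluteGaloisGroup K) [Fact (κ.IsTopGenerator γ)],
      ∀ (N : ℕ) [NeZero N] (Dt : ModularParametrizationData W N)
        (H : HeegnerDatum N (NumberField.discr K)) (ιC : K →+* ℂ) (P : (W.baseChange K).toAffine.Point),
        WeierstrassCurve.Affine.Point.map ιC.toRatAlgHom P = heegnerPointComplex Dt H →
        Module.IsTorsion (IwasawaAlgebra p) (AcSelmer.XAc (W.baseChange K) p κ vbar ∅ γ) ∧
        ∃ F : IwasawaAlgebra p,
          AcSelmer.XAc.charIdeal (W.baseChange K) p κ vbar ∅ γ = Ideal.span {F} ∧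
          PowerSeries.constantCoeff F ≠ 0 ∧
          ∃ u : ℤ_[p]ˣ,
            ((PowerSeries.constantCoeff F : ℤ_[p]) : ℚ_[p]) =
              ((u : ℤ_[p]) : ℚ_[p]) * ((Dt.c : ℚ_[p])⁻¹) ^ 2 *
                (1 - (W.frobeniusTrace p : ℚ_[p]) * (p : ℚ_[p])⁻¹ + (p : ℚ_[p])⁻¹) ^ 2 *
                ((W.baseChange ℚ_[p]).padicLogPoint (formalIndex W p • padicPointOf W p ι P) /
                  (formalIndex W p : ℚ_[p])) ^ 2 :=
  fun W _ _ p _ hp hgood hred hanom hGL K _ _ hK hHN hHp hodd h3 hEK hrank hfin ι v vbar hv hvbar hne κ hκ γ _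
      N _ Dt H ιC P hP ↦
    cycLineBDPValue_of_localTransport h511 h2 W p hp hgood hred hanom hGL K hK hHN hHp hodd h3 hEK hrank hfin
      ι v vbar hv hvbar hne κ hκ γ N Dt H ιC P hP
      (fun hSel hP₀ hvp κm hκm γm _ n hn ↦
        hK1 W p hp hgood K hK hHN hHp hSel hP₀ v vbar hvp hvbar hne κ κm hκ hκm γ γm n hn)

/-- **The same stub fed by PRINT instead of (K1): crux 2 ∘ [CGS25, Prop. 3.4.2 at `α = 𝟙`] ⟹ the
BDP value on the cyclotomic line at the good lattice.** Castella–Grossi–Skinner's two-line Euler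
characteristic (Prop. 3.4.2 `prop:euler-char` with Lemma 3.4.1, final TeX l. 1469–1576) is printed
under `E(K)[p] = 0`, (a) `corank Sel_{p^∞}(E/K) = 1`, (b) `loc_v ≠ 0` (here: a point of infinite
order) and the §3 standing hypotheses (`p` odd good ordinary; (Heeg), (spl)), with NO non-anomalous
hypothesis; it is taken here UNFOLDED as the hypothesis `h342` (both `X_Gr(E/K_∞^±)` torsion and
`ord_p 𝓕⁻(0) = n ⟺ ord_p 𝓕⁺(0) = n`; the typed named fact
`CastellaGrossiSkinner2025.prop342_twoLineEulerChar_trivialChar` has this body). At the good lattice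
`E_g(K)[p] = 0` and good ordinary reduction are BINDERS / consequences of the data, so the
torsion-allowing (K1) is not needed: the line's (K1) slot becomes a PUBLISHED named fact. CONDITIONAL
on `h2` (crux 2, open) and on the refereed named facts `h511`, `h342`.
[cite: CastellaGrossiSkinner2025, Prop. 3.4.2 and Lemma 3.4.1 (§3.4.1), §5 Step 3]
[cite: CastellaGrossiLeeSkinner2022, Thm. 5.1.1 and its proof] [cite: KellerYin2024, Thm. 3.0.8 (IMC2)] -/
theorem stub_plusLineValue_of_prop342
    (h511 : CastellaGrossiLeeSkinner2022.thm511_anticyclotomicControl_of_torsionFree)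
    (h2 : Summit.BirchSwinnertonDyer.BirchSwinnertonDyer.Theses.EisensteinPrimes.GoodLatticeBDPValue)
    (h342 : ∀ (W : WeierstrassCurve ℚ) [W.IsElliptic] [W.IsGloballyMinimal] (p : ℕ) [Fact p.Prime],
      2 < p → GoodOrd W p →
      ∀ (K : Type) [Field K] [NumberField K], IsImaginaryQuadratic K →
        SatisfiesHeegnerHypothesis (W.conductorNorm ℤ) K → SatisfiesHeegnerHypothesis p K →
        (∀ Q : (W.baseChange K).toAffine.Point, p • Q = 0 → Q = 0) →
        (W.baseChange K).selmerCorank p = 1 →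
        (∃ P : (W.baseChange K).toAffine.Point, ¬ IsOfFinAddOrder P) →
      ∀ (v vbar : HeightOneSpectrum (𝓞 K)),
        ((p : ℕ) : 𝓞 K) ∈ v.asIdeal → ((p : ℕ) : 𝓞 K) ∈ vbar.asIdeal → vbar ≠ v →
      ∀ (κp κm : ZpExtension K p), κp.IsCyclotomic → κm.IsAnticyclotomic →
      ∀ (γp γm : absoluteGaloisGroup K) [Fact (κp.IsTopGenerator γp)] [Fact (κm.IsTopGenerator γm)],
        Module.IsTorsion (IwasawaAlgebra p) (AcSelmer.XAc (W.baseChange K) p κp vbar ∅ γp) ∧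
        Module.IsTorsion (IwasawaAlgebra p) (AcSelmer.XAc (W.baseChange K) p κm vbar ∅ γm) ∧
        ∀ n : ℕ, AcSelmer.XAc.HasCharValuationAt (W.baseChange K) p κm vbar ∅ γm n ↔
          AcSelmer.XAc.HasCharValuationAt (W.baseChange K) p κp vbar ∅ γp n) :
    ∀ (W : WeierstrassCurve ℚ) [W.IsElliptic] [W.IsGloballyMinimal] (p : ℕ) [Fact p.Prime],
      2 < p → Good W p → Red W p → Anom W p →
      (∀ Φ : AddSubgroup (geomTorsion W (p : ℤ)), IsRationalLine W p Φ → ¬ LineUnramifiedAt W p Φ) →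
      ∀ (K : Type) [Field K] [NumberField K], IsImaginaryQuadratic K →
        SatisfiesHeegnerHypothesis (W.conductorNorm ℤ) K → SatisfiesHeegnerHypothesis p K →
        Odd (NumberField.discr K) → NumberField.discr K ≠ -3 →
        (∀ Q : (W.baseChange K).toAffine.Point, p • Q = 0 → Q = 0) →
        (W.baseChange K).mordellWeilRank = 1 →
        Finite (AddCommGroup.primaryComponent (W.baseChange K).sha p) →
      ∀ (ι : K →+* ℚ_[p]) (v vbar : HeightOneSpectrum (𝓞 K)),
        (∀ x : 𝓞 K, x ∈ v.asIdeal ↔ ‖ι (x : K)‖ < 1) →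
        ((p : ℕ) : 𝓞 K) ∈ vbar.asIdeal → vbar ≠ v →
      ∀ (κ : ZpExtension K p), κ.IsCyclotomic →
      ∀ (γ : absoluteGaloisGroup K) [Fact (κ.IsTopGenerator γ)],
      ∀ (N : ℕ) [NeZero N] (Dt : ModularParametrizationData W N)
        (H : HeegnerDatum N (NumberField.discr K)) (ιC : K →+* ℂ) (P : (W.baseChange K).toAffine.Point),
        WeierstrassCurve.Affine.Point.map ιC.toRatAlgHom P = heegnerPointComplex Dt H →
        Module.IsTorsion (IwasawaAlgebra p) (AcSelmer.XAc (W.baseChange K) p κ vbar ∅ γ) ∧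
        ∃ F : IwasawaAlgebra p,
          AcSelmer.XAc.charIdeal (W.baseChange K) p κ vbar ∅ γ = Ideal.span {F} ∧
          PowerSeries.constantCoeff F ≠ 0 ∧
          ∃ u : ℤ_[p]ˣ,
            ((PowerSeries.constantCoeff F : ℤ_[p]) : ℚ_[p]) =
              ((u : ℤ_[p]) : ℚ_[p]) * ((Dt.c : ℚ_[p])⁻¹) ^ 2 *
                (1 - (W.frobeniusTrace p : ℚ_[p]) * (p : ℚ_[p])⁻¹ + (p : ℚ_[p])⁻¹) ^ 2 *
                ((W.baseChange ℚ_[p]).padicLogPoint (formalIndex W p • padicPointOf W p ι P) /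
                  (formalIndex W p : ℚ_[p])) ^ 2 :=
  fun W _ _ p _ hp hgood hred hanom hGL K _ _ hK hHN hHp hodd h3 hEK hrank hfin ι v vbar hv hvbar hne κ hκ γ _
      N _ Dt H ιC P hP ↦
    cycLineBDPValue_of_localTransport h511 h2 W p hp hgood hred hanom hGL K hK hHN hHp hodd h3 hEK hrank hfin
      ι v vbar hv hvbar hne κ hκ γ N Dt H ιC P hP
      (fun hSel hP₀ hvp κm hκm γm _ n hn ↦
        ((h342 W p hp (goodOrd_of_red_of_good W p hp hgood hred) K hK hHN hHp hEK hSel hP₀ v vbar hvp hvbar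
          hne κ κm hκ hκm γ γm).2.2 n).mp hn)

end Summit.BirchSwinnertonDyer.BirchSwinnertonDyer.Theorems.InterludeWithTorsion

end
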